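import Summits.CriticalPhenomena.PercolationContinuityZ3.Theorems.PercNearOneGluingNoHeavyLowerTailMajorityGluingTypeTableCertificates
import Summits.CriticalPhenomena.PercolationContinuityZ3.Theorems.PercNearOneGluingNoHeavyLowerTailMajorityGluingTypeTableLPCert
import HarnessLib

/-!
# The fixed-`M` programme in the kernel, template A: rows as checkable data, and the FAMILY THEOREM `E ≤ V`
(lane prim-rate, constants-miner 1, gen 28; KERNEL-WINDOW.md §1/§3 items (d),(f); CONVEX-BOOTSTRAP.md §5, DERIVATIONS.md M1–M4)

Support file for the closed crux `NoHeavyLowerTail` (stmt-CriticalPhenomena-4575), majority-gluing line; companion of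
`…TypeTableLPCert` (the LP dual check `checkCert` and its soundness) and `…TypeTableCertificates` (the engine `lin_combo`,
LEMMA B).  A window certificate bounds `E = E f/δ₁ − 1` over the laws of a CASE (a `T`-order of the relays and a
rich / not-rich flag per relay) by an LP over rows that every law of the case satisfies.  Here the rows are DATA with a
decidable validity check, so that a whole programme is verified by ONE `decide`:

* `FRow` — the row kinds of template A (= c25/progM2 without the ISO rows): the 22 O-free linear vdBHK rows, the
  normalisation `x(v₁ cut) ≤ 1`, order rows `T_q ≤ T_p`, band rows (`2T_z ≤ S_z` rich / `S_z ≤ 2T_z` not rich), the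
  relay-root consequences `x(P_zy) ≤ 2x(C_zy)` for a not-rich `z`, and PAIR CUTS `N·T_lo − G·x(C_ab) ≤ H` — every
  tangent of `T_lo ≤ √x(C_ab)` (hub-pair van den Berg–Kahn row `T_aT_b ≤ x(C_ab)·x(all cut)`, `x(all cut) ≤ 1`,
  `T_lo` the smaller layer of the pair in the case's order) satisfies `N² ≤ 4GH`, which is the whole check: no support
  point and no irrational constant is needed for the pair rows;
* `toRow`, `rowOK`, `checkFM` (computable) and **`fixedM_sound`**: if `checkFM cs ks y V = true` then every nonnegative
  law of case `cs` obeying the programme's hypotheses (linear rows, normalisation, the case's order and bands, the six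
  hub-pair rows, the twelve relay-root rows in reduced form) has `E(x) ≤ V`.

Template A is `M`-free (it bounds `sup E` over all hub weights at once — numerically weak); the `M`-dependent ISO₃/ISO₄/ISO₅
tangent rows (constants certified by `…ConvexBootstrapRpowCert`, validity by `…ConvexBootstrapTangent`) are template B.
A SUBSET of valid rows is still a valid relaxation: certificates for any row subset are sound.  No percolation, no sorries.
[cite: VandenbergHaggstromKahn2005, Thm. 1.3 (p. 6)]
-/

namespace Summit.CriticalPhenomena.PercolationContinuityZ3.Theorems

namespace HubOnly
namespace TypeTable

open DType

/-! ### The rows of template A as data -/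

/-- The 22 `O`-free linear vdBHK row functionals (`B₂,B₃,B₄, Calone, Cpair, Ctriple, Cnotfull, CaloneY, Cnotalone`; each row
is `lin φ x ≤ 0`). -/
def linFree : List (DType → ℤ) :=
  [fun τ => τ.bud 2, fun τ => τ.bud 3, fun τ => τ.bud 4, fun τ => τ.calone 2, fun τ => τ.calone 3, fun τ => τ.calone 4,
   fun τ => τ.cpair 2 3, fun τ => τ.cpair 2 4, fun τ => τ.cpair 3 4, fun τ => τ.ctriple, fun τ => τ.cnotfull 2,
   fun τ => τ.cnotfull 3, fun τ => τ.cnotfull 4, fun τ => τ.caloneY 2 3, fun τ => τ.caloneY 2 4,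
   fun τ => τ.caloneY 3 2, fun τ => τ.caloneY 3 4, fun τ => τ.caloneY 4 2, fun τ => τ.caloneY 4 3,
   fun τ => τ.cnotalone 2, fun τ => τ.cnotalone 3, fun τ => τ.cnotalone 4]

/-- A CASE of the fixed-`M` programme: the `T`-order of the relays (a list, larger layers first) and the richness flags
(`rich z`: `S_z ≥ 2T_z`; else `S_z ≤ 2T_z`). -/
structure FMCase where
  /-- relays in non-increasing order of their layer masses `T_z` -/
  ord : List ℕ
  /-- `rich z = true`: relay `z` carries the band `S_z ≥ 2T_z` -/
  rich : ℕ → Bool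

/-- `p` comes before `q` in the order list (so the case asserts `T_q ≤ T_p`). -/
def FMCase.before (cs : FMCase) (p q : ℕ) : Bool :=
  decide (p ∈ cs.ord) && decide (q ∈ cs.ord) && decide (cs.ord.idxOf p < cs.ord.idxOf q)

/-- Row kinds of template A. -/
inductive FRow where
  /-- the `i`-th `O`-free linear row `lin (linFree[i]) x ≤ 0` -/
  | linfree (i : ℕ)
  /-- the normalisation `x(v₁ cut) ≤ 1` -/
  | norm
  /-- order row `T_q − T_p ≤ 0` (`p` before `q`) -/
  | order (p q : ℕ)
  /-- rich band `2T_z − S_z ≤ 0` -/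
  | richBand (z : ℕ)
  /-- not-rich band `S_z − 2T_z ≤ 0` -/
  | poorBand (z : ℕ)
  /-- relay-root consequence `x(P_zy) − 2x(C_zy) ≤ 0` for a not-rich `z` -/
  | relay (z y : ℕ)
  /-- pair cut `N·T_lw − G·x(C_ab) ≤ H` (`lw` = the relay of the pair with the smaller layer) -/
  | pair (a b lw N G : ℕ) (H : ℚ)

/-- The `Row` (functional, right-hand side) of a row kind. -/
def toRow : FRow → Row
  | .linfree i => ⟨linFree.getD i (fun _ => 0), 0⟩
  | .norm => ⟨fun τ => τ.cutZ 1, 1⟩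
  | .order p q => ⟨combo [(1, fun τ => ind (τ.isT q)), (-1, fun τ => ind (τ.isT p))], 0⟩
  | .richBand z => ⟨combo [(2, fun τ => ind (τ.isT z)), (-1, fun τ => ind (τ.isS z))], 0⟩
  | .poorBand z => ⟨combo [(1, fun τ => ind (τ.isS z)), (-2, fun τ => ind (τ.isT z))], 0⟩
  | .relay z y => ⟨combo [(1, fun τ => ind (τ.isP z y)), (-2, fun τ => ind (τ.isC z y))], 0⟩
  | .pair a b lw N G H => ⟨combo [((N : ℤ), fun τ => ind (τ.isT lw)), (-(G : ℤ), fun τ => ind (τ.isC a b))], H⟩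

/-- Validity check of a row kind against the case: order rows follow the order list, band / relay rows the flags, and a
pair cut `(a,b,lo,N,G,H)` needs `a < b` relays, `lo` the LATER of the two in the order, `G > 0` and `N² ≤ 4GH`. -/
def rowOK (cs : FMCase) : FRow → Bool
  | .linfree _ => true
  | .norm => true
  | .order p q => cs.before p q
  | .richBand z => decide (z ∈ [1, 2, 3, 4]) && cs.rich z
  | .poorBand z => decide (z ∈ [1, 2, 3, 4]) && !cs.rich z
  | .relay z y => decide (z ∈ [1, 2, 3, 4]) && decide (y ∈ [1, 2, 3, 4]) && !decide (z = y) && !cs.rich z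
  | .pair a b lw N G H => decide (a ∈ [1, 2, 3, 4]) && decide (b ∈ [1, 2, 3, 4]) && decide (a < b) &&
      ((decide (lw = b) && cs.before a b) || (decide (lw = a) && cs.before b a)) &&
      decide (0 < G) && decide (((N : ℚ) ^ 2) ≤ 4 * (G : ℚ) * H)

/-- **The programme check**: every row kind valid for the case, `0 ≤ V`, and the LP dual certificate accepted. -/
def checkFM (cs : FMCase) (ks : List FRow) (y : List ℚ) (V : ℚ) : Bool :=
  ks.all (rowOK cs) && decide (0 ≤ V) && checkCert eZ (ks.map toRow) y V

/-! ### Law-level validity of the rows -/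

noncomputable section

/-- `x(all four relays cut) ≤ x(v₁ cut)` typewise, hence `x(all cut) ≤ 1` under the normalisation. -/
theorem allCut_combo : ∀ τ ∈ allTypes, combo [(1, fun τ => ind τ.allCut), (-1, fun τ => τ.cutZ 1)] τ ≤ 0 := by
  decide +kernel

/-- `x(all cut) ≤ 1` under `x(v₁ cut) ≤ 1`. -/
theorem ACm_le_one (x : DType → ℝ) (hx : ∀ τ, 0 ≤ x τ) (hnorm : lin (fun τ => τ.cutZ 1) x ≤ 1) : ACm x ≤ 1 := by
  have h := cc_bound _ x allCut_combo hx
  simp only [List.map_cons, List.map_nil, List.sum_cons, List.sum_nil] at h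
  push_cast at h
  simp only [ACm]
  linarith

/-- The pair-cut inequality: `T² ≤ C`, `0 < G`, `N² ≤ 4GH` ⟹ `N·T − G·C ≤ H` (every tangent of `√·` lies above it). -/
theorem pair_cut_real {T C N G H : ℝ} (hTC : T ^ 2 ≤ C) (hG : 0 < G) (hNGH : N ^ 2 ≤ 4 * G * H) :
    N * T - G * C ≤ H := by
  have h1 : G * T ^ 2 ≤ G * C := mul_le_mul_of_nonneg_left hTC hG.le
  have h2 : 0 ≤ (2 * G * T - N) ^ 2 := sq_nonneg _
  have h3 : 4 * G * (H - (N * T - G * T ^ 2)) ≥ 0 := by nlinarith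
  have h4 : H - (N * T - G * T ^ 2) ≥ 0 := by
    by_contra hc
    push Not at hc
    nlinarith
  nlinarith

/-- `T_lo² ≤ x(C_ab)` from the hub-pair row, `x(all cut) ≤ 1` and `T_lo ≤ T_hi`. -/
theorem sq_le_C {Tlo Thi C AC : ℝ} (hlo : 0 ≤ Tlo) (hC : 0 ≤ C) (hAC1 : AC ≤ 1) (hord : Tlo ≤ Thi)
    (hub : Tlo * Thi ≤ C * AC ∨ Thi * Tlo ≤ C * AC) : Tlo ^ 2 ≤ C := by
  have hprod : Tlo * Thi ≤ C * AC := by rcases hub with h | h <;> linarith [mul_comm Tlo Thi]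
  have h1 : C * AC ≤ C := by nlinarith
  nlinarith

/-- Relay-root consequence at law level: `T_z > 0`, `S_z ≤ 2T_z` and `(x(C) + x(P))·T_z ≤ x(C)·(T_z + S_z)` ⟹
`x(P) ≤ 2x(C)`. -/
theorem P_le_two_C {T S C P : ℝ} (hT : 0 < T) (hC : 0 ≤ C) (hrich : S ≤ 2 * T)
    (rel : (C + P) * T ≤ C * (T + S)) : P ≤ 2 * C := by
  have h1 : C * (T + S) ≤ C * (3 * T) := mul_le_mul_of_nonneg_left (by linarith) hC
  by_contra h
  push Not at h
  nlinarith

/-- The hypotheses of the fixed-`M` programme (template A) on a law `x` in case `cs`. -/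
structure FMLaw (cs : FMCase) (x : DType → ℝ) : Prop where
  /-- nonnegative masses -/
  nonneg : ∀ τ, 0 ≤ x τ
  /-- the 22 `O`-free linear vdBHK rows -/
  linRows : ∀ φ ∈ linFree, lin φ x ≤ 0
  /-- normalisation `x(v₁ cut) ≤ 1` -/
  norm : lin (fun τ => τ.cutZ 1) x ≤ 1
  /-- the case's order: `p` before `q` ⟹ `T_q ≤ T_p` -/
  order : ∀ p q, cs.before p q = true → Tm q x ≤ Tm p x
  /-- the case's bands -/
  richB : ∀ z ∈ [1, 2, 3, 4], cs.rich z = true → 2 * Tm z x ≤ Sm z x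
  /-- the case's bands -/
  poorB : ∀ z ∈ [1, 2, 3, 4], cs.rich z = false → Sm z x ≤ 2 * Tm z x
  /-- the six hub-pair van den Berg–Kahn rows -/
  hub : ∀ a ∈ [1, 2, 3, 4], ∀ b ∈ [1, 2, 3, 4], a < b → Tm a x * Tm b x ≤ Cm a b x * ACm x
  /-- the twelve relay-root rows in reduced form -/
  rel : ∀ r ∈ [1, 2, 3, 4], ∀ z ∈ [1, 2, 3, 4], r ≠ z → (Cm r z x + Pm r z x) * Tm r x ≤ Cm r z x * (Tm r x + Sm r x)

/-- The budgets are the first three `O`-free rows. -/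
theorem FMLaw.budgets {cs : FMCase} {x : DType → ℝ} (L : FMLaw cs x) :
    lin (fun τ => τ.bud 2) x ≤ 0 ∧ lin (fun τ => τ.bud 3) x ≤ 0 ∧ lin (fun τ => τ.bud 4) x ≤ 0 :=
  ⟨L.linRows _ (by simp [linFree]), L.linRows _ (by simp [linFree]), L.linRows _ (by simp [linFree])⟩

/-- LEMMA B at law level for every relay: `E ≤ T_z`. -/
theorem FMLaw.E_le_Tm {cs : FMCase} {x : DType → ℝ} (L : FMLaw cs x) : ∀ z ∈ [1, 2, 3, 4], E x ≤ Tm z x := by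
  obtain ⟨hB2, hB3, hB4⟩ := L.budgets
  intro z hz
  simp only [List.mem_cons, List.not_mem_nil, or_false] at hz
  rcases hz with rfl | rfl | rfl | rfl
  · have h := E_eq_T1_sub_Q x
    have hQ := lin_ind_nonneg (fun τ => τ.eZ == -1) L.nonneg
    linarith
  · exact (E_le_T 2 (by simp) x L.nonneg hB2).2
  · exact (E_le_T 3 (by simp) x L.nonneg hB3).2
  · exact (E_le_T 4 (by simp) x L.nonneg hB4).2

/-- **Row validity.**  If all layers are positive, every row kind accepted by `rowOK cs` holds for every law of the case. -/
theorem row_valid {cs : FMCase} {x : DType → ℝ} (L : FMLaw cs x) (hpos : ∀ z ∈ [1, 2, 3, 4], 0 < Tm z x)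
    (k : FRow) (hk : rowOK cs k = true) : lin (toRow k).φ x ≤ ((toRow k).b : ℝ) := by
  have hx := L.nonneg
  cases k with
  | linfree i =>
    simp only [toRow, Rat.cast_zero]
    by_cases hi : i < linFree.length
    · have hmem : linFree.getD i (fun _ => 0) ∈ linFree := by
        rw [List.getD_eq_getElem _ _ hi]; exact List.getElem_mem hi
      exact L.linRows _ hmem
    · rw [List.getD_eq_default _ _ (by omega)]
      exact le_of_eq (lin_eq_zero fun τ _ => rfl)
  | norm => simpa [toRow] using L.norm
  | order p q =>
    simp only [rowOK] at hk
    have h := L.order p q hk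
    simp only [toRow, lin_combo, List.map_cons, List.map_nil, List.sum_cons, List.sum_nil, Rat.cast_zero]
    push_cast
    simp only [Tm] at h
    linarith
  | richBand z =>
    simp only [rowOK, Bool.and_eq_true, decide_eq_true_eq] at hk
    have h := L.richB z hk.1 hk.2
    simp only [toRow, lin_combo, List.map_cons, List.map_nil, List.sum_cons, List.sum_nil, Rat.cast_zero]
    push_cast
    simp only [Tm, Sm] at h
    linarith
  | poorBand z =>
    simp only [rowOK, Bool.and_eq_true, decide_eq_true_eq, Bool.not_eq_true'] at hk
    have h := L.poorB z hk.1 hk.2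
    simp only [toRow, lin_combo, List.map_cons, List.map_nil, List.sum_cons, List.sum_nil, Rat.cast_zero]
    push_cast
    simp only [Tm, Sm] at h
    linarith
  | relay z y =>
    simp only [rowOK, Bool.and_eq_true, decide_eq_true_eq, Bool.not_eq_true', decide_eq_false_iff_not] at hk
    obtain ⟨⟨⟨hz, hy⟩, hzy⟩, hr⟩ := hk
    have hband := L.poorB z hz hr
    have hrel := L.rel z hz y hy hzy
    have hP := P_le_two_C (hpos z hz) (lin_ind_nonneg _ hx) hband hrel
    simp only [toRow, lin_combo, List.map_cons, List.map_nil, List.sum_cons, List.sum_nil, Rat.cast_zero]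
    push_cast
    simp only [Pm] at hP
    linarith
  | pair a b lw N G H =>
    simp only [rowOK, Bool.and_eq_true, decide_eq_true_eq, Bool.or_eq_true] at hk
    obtain ⟨⟨⟨⟨⟨ha, hb⟩, hab⟩, hlw⟩, hG⟩, hNGH⟩ := hk
    have hAC := ACm_le_one x hx L.norm
    have hhub := L.hub a ha b hb hab
    have hC0 : 0 ≤ Cm a b x := lin_ind_nonneg _ hx
    have hsq : Tm lw x ^ 2 ≤ Cm a b x := by
      rcases hlw with ⟨rfl, hbef⟩ | ⟨rfl, hbef⟩
      · exact sq_le_C (lin_ind_nonneg _ hx) hC0 hAC (L.order a _ hbef) (Or.inr hhub)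
      · exact sq_le_C (lin_ind_nonneg _ hx) hC0 hAC (L.order b _ hbef) (Or.inl hhub)
    have hG' : (0 : ℝ) < (G : ℝ) := by exact_mod_cast hG
    have hNGH' : ((N : ℝ)) ^ 2 ≤ 4 * (G : ℝ) * (H : ℝ) := by exact_mod_cast hNGH
    have h := pair_cut_real hsq hG' hNGH'
    simp only [toRow, lin_combo, List.map_cons, List.map_nil, List.sum_cons, List.sum_nil]
    push_cast
    simp only [Tm, Cm] at h
    linarith

/-- **THE FAMILY THEOREM (template A).**  If `checkFM cs ks y V = true` — all row kinds valid for the case, `V ≥ 0`, and the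
LP dual certificate `(y, V)` accepted for the objective `e` over the rows — then `E(x) ≤ V` for every law of the fixed-`M`
programme in case `cs`. -/
theorem fixedM_sound {cs : FMCase} {ks : List FRow} {y : List ℚ} {V : ℚ} (hchk : checkFM cs ks y V = true)
    {x : DType → ℝ} (L : FMLaw cs x) : E x ≤ (V : ℝ) := by
  simp only [checkFM, Bool.and_eq_true, List.all_eq_true, decide_eq_true_eq] at hchk
  obtain ⟨⟨hks, hV⟩, hcert⟩ := hchk
  by_cases hpos : ∀ z ∈ [1, 2, 3, 4], 0 < Tm z x
  · have hrows : ∀ r ∈ ks.map toRow, lin r.φ x ≤ (r.b : ℝ) := by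
      intro r hr
      obtain ⟨k, hk, rfl⟩ := List.mem_map.mp hr
      exact row_valid L hpos k (hks k hk)
    obtain ⟨hB2, hB3, hB4⟩ := L.budgets
    have h1 := nonInert_le_one x L.nonneg L.norm hB2 hB3 hB4
    exact lpCert_sound hcert x L.nonneg h1 hrows
  · push Not at hpos
    obtain ⟨z, hz, hTz⟩ := hpos
    have hE := L.E_le_Tm z hz
    have hV' : (0 : ℝ) ≤ (V : ℝ) := by exact_mod_cast hV
    linarith

end

/-! ### Smoke test: a two-row programme -/

/-- Smoke test of the evaluation path: case «order (1,2,3,4), no relay rich», rows `[B₂, normalisation, T₂ ≤ T₁,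
S₁ ≤ 2T₁, x(P₁₂) ≤ 2x(C₁₂), pair cut 2T₂ − x(C₁₂) ≤ 1]`, multipliers `(0,1,0,0,0,0)`, `V = 6` (`= 1` from the normalisation
row `+ 5` absorbed deficits: the five types with `v₁` attached alone and `v₂,v₃,v₄` cut carry `e = 1`). -/
theorem checkFM_smoke :
    checkFM ⟨[1, 2, 3, 4], fun _ => false⟩ [.linfree 0, .norm, .order 1 2, .poorBand 1, .relay 1 2, .pair 1 2 2 2 1 1]
      [0, 1, 0, 0, 0, 0] 6 = true := by
  decide +kernel

end TypeTable
end HubOnly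

end Summit.CriticalPhenomena.PercolationContinuityZ3.Theorems
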